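import Summits.CriticalPhenomena.PercolationContinuityZ3.Theorems.Transplant.FKConnectivityAllQK5DisjSlices
import Summits.CriticalPhenomena.PercolationContinuityZ3.Theorems.Transplant.FKConnectivityAllQK5DisjCert0b
import Summits.CriticalPhenomena.PercolationContinuityZ3.Theorems.Transplant.FKConnectivityAllQK5DisjCert1b
import Summits.CriticalPhenomena.PercolationContinuityZ3.Theorems.Transplant.FKConnectivityAllQK5DisjCert2b
import Summits.CriticalPhenomena.PercolationContinuityZ3.Theorems.Transplant.FKConnectivityAllQK5DisjCert3
import Summits.CriticalPhenomena.PercolationContinuityZ3.Theorems.Transplant.FKConnectivityAllQK5DisjCert4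
import HarnessLib

/-!
# `K₅` is Potts–Rayleigh for every `0 < q ≤ 1` — edge-negative association of `φ_{w,q}` on every weighted graph with at most five vertices

Helper file (`--supports stmt-CriticalPhenomena-4575`), FK sub-lane `prim-bschramm-fk-3` (gen 11) of the post-continuity programme;
builds on p205010 (kernel theorem, internal audit signed; external expert review pending).  No named facts, no sorries; standard axioms.

THE THEOREM OF THIS CHAIN (`…K5Disj`): **`K₅` is Potts–Rayleigh for every `0 < q ≤ 1`** — the random-cluster measure `φ_{w,q}` on every
weighted graph with at most five vertices is edge-negatively associated, `φ(J_e ∩ J_f) ≤ φ(J_e)φ(J_f)` for ALL pairs `e ≠ f` (adjacent pairs: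
gen 10, `…K5`; this chain: the disjoint pairs, one `S₅`-orbit, `(e, f) = (01, 23)`).  Wagner 2008, Ex. 5.2 records Sokal's computation for
`K₄`; for `K₅` the Rayleigh difference `Z¹⁰Z⁰¹ − Z⁰⁰Z¹¹` of `(01, 23)` has negative coefficients that no binomial (AM–GM) square repairs
(gen 10, LP scoping), so the certificate is a SUM OF GRAM SQUARES: with `y` the odds parameters of the eight pairs `E₈' = K₅ − {01, 23}`,
the reduced difference `D̂ = (Z¹⁰Z⁰¹ − Z⁰⁰Z¹¹)/(q²(1−q))` (degree `4` in `q`) is written in the scaled Bernstein basis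
`Σ_{j ≤ 4} B̃_j(y) q^j (1−q)^{4−j}`, and each slice `B̃_j` is certified `≥ 0` on the orthant as
`B̃_j = Σ_T y^T · m_Tᵀ H_{T,j} m_T + (nonnegative coefficients)`, `|T| ≤ 2`, `m_T` the multi-affine monomials off `T` inside the
Newton polytope, `H_{T,j} = U K Uᵀ` integer positive semidefinite (witness `s²K = LLᵀ + E`, `E` diagonally dominant).  The certificates
were found by semidefinite programming, facial reduction and integer rounding OUTSIDE Lean (bschramm/FK-BARRIER.md §15) and are CHECKED
HERE BY THE KERNEL (`decide +kernel`), fiber by fiber (`3^8 = 6561` fibers per slice).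
[cite: Wagner2006, Ex. 5.2, Conj. 5.3, Thm. 5.8 (p. 13)] [cite: Grimmett2006, §3.9 eq. (3.94), Conj. (3.96) (pp. 63–66); §1.4 eq. (1.20) (p. 15)]

THIS FILE (the assembly): the five kernel-checked slices (`sliceCertified_zero … _four`) ⇒ `nc_norm_d5` unconditionally;
**`edgeNegCorrOn_fin_five`** (`K₅` and all its weighted subgraphs, loops allowed); `edgeNegCorrOn_fin_of_le_five`,
**`edgeNegCorrOn_of_card_le_five`** (every finite vertex type with at most five elements); and fk-1's consequences for `0 < q < 1`:
single-edge monotonicity of connection probabilities (`edgeConnMonoOn`), pairwise positive correlation of connection events and the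
hub inequality on every weighted graph with at most five vertices (previously kernel for `≤ 4` vertices, `…FKRayleighK4`).
-/

noncomputable section

namespace Summit.CriticalPhenomena.PercolationContinuityZ3.Theorems

namespace FK


open MeasureTheory Literature.Probability.LatticeModels Literature.Probability.Percolation
open scoped Classical

/-- **All five slices of the `K₅` disjoint-pair certificate are kernel-certified.** [folklore] -/
theorem K5D.sliceCertified_all : ∀ j ≤ 4, K5D.SliceCertified j := by
  intro j hj
  interval_cases j
  exacts [K5D.sliceCertified_zero, K5D.sliceCertified_one, K5D.sliceCertified_two, K5D.sliceCertified_three, K5D.sliceCertified_four]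

/-- **`K₅` is Potts–Rayleigh, disjoint pairs** (unconditional): for a loop-free weight vector on `Fin 5` and `0 < q ≤ 1`,
`φ(J_{01} ∩ J_{23}) ≤ φ(J_{01})·φ(J_{23})`. [cite: Wagner2006, Ex. 5.2, Conj. 5.3] [cite: Grimmett2006, §3.9 eq. (3.94) (p. 63)] -/
theorem nc_norm_d5 (w : Sym2 (Fin 5) → unitInterval) (hw : ∀ x : Fin 5, (w s(x, x) : ℝ) = 0) {q : ℝ} (hq0 : 0 < q)
    (hq1 : q ≤ 1) :
    (rcMeasureW w q ∅).real ({ω | s((0 : Fin 5), 1) ∈ ω} ∩ {ω | s((2 : Fin 5), 3) ∈ ω}) ≤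
      (rcMeasureW w q ∅).real {ω | s((0 : Fin 5), 1) ∈ ω} * (rcMeasureW w q ∅).real {ω | s((2 : Fin 5), 3) ∈ ω} :=
  K5D.nc_norm_d5 K5D.sliceCertified_all w hw hq0 hq1

/-- **`K₅` is Potts–Rayleigh for every `0 < q ≤ 1`**: the random-cluster measure `φ_{w,q}` on the pairs of `Fin 5` — every weighted
graph with five vertices, loops allowed — is edge-negatively associated: `φ(J_e ∩ J_f) ≤ φ(J_e)·φ(J_f)` for `e` not a loop and `f ≠ e`.
(Wagner 2008, Ex. 5.2: `K₄`, a computation of Sokal; `K₅` is new in the tree and, to our knowledge, in print.)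
[cite: Wagner2006, Ex. 5.2, Conj. 5.3, Thm. 5.8] [cite: Grimmett2006, §3.9 eq. (3.94), Conj. (3.96) (pp. 63–66)] -/
theorem edgeNegCorrOn_fin_five {q : ℝ} (hq0 : 0 < q) (hq1 : q ≤ 1) : EdgeNegCorrOn (Fin 5) q :=
  K5D.edgeNegCorrOn_fin_five_of_cert K5D.sliceCertified_all hq0 hq1

/-- **Edge-negative association of `φ_{w,q}` on `Fin n`, `n ≤ 5`, `0 < q ≤ 1`** (`n ≤ 4`: `…FKRayleighK4`; `n = 5`: this file).
[cite: Wagner2006, Ex. 5.2, Thm. 5.8(d), §5.3] [cite: Grimmett2006, §3.9 eq. (3.94) (p. 63)] -/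
theorem edgeNegCorrOn_fin_of_le_five {n : ℕ} (hn : n ≤ 5) {q : ℝ} (hq0 : 0 < q) (hq1 : q ≤ 1) : EdgeNegCorrOn (Fin n) q := by
  rcases Nat.lt_or_ge n 5 with hlt | hge
  · exact edgeNegCorrOn_fin_of_le_four (by omega) hq0 hq1
  · obtain rfl : n = 5 := le_antisymm hn hge
    exact edgeNegCorrOn_fin_five hq0 hq1

/-- **Edge-negative association of `φ_{w,q}` on every finite vertex type with at most five elements, `0 < q ≤ 1`** (relabelling to
`Fin n`): every weighted graph with at most five vertices is Potts–Rayleigh.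
[cite: Wagner2006, Ex. 5.2, Conj. 5.3, §5.3] [cite: Grimmett2006, §3.9 eq. (3.94) (p. 63); §4.3] -/
theorem edgeNegCorrOn_of_card_le_five {V : Type*} [Fintype V] (hV : Fintype.card V ≤ 5) {q : ℝ} (hq0 : 0 < q) (hq1 : q ≤ 1) :
    EdgeNegCorrOn V q := by
  classical
  intro w e f he hfe
  set σ : Fin (Fintype.card V) ≃ V := (Fintype.equivFin V).symm
  have hne' : (sym2Equiv σ).symm f ≠ (sym2Equiv σ).symm e := fun h => hfe ((sym2Equiv σ).symm.injective h)
  have hdiag : ∀ z : Sym2 (Fin (Fintype.card V)), z.IsDiag → (sym2Equiv σ z).IsDiag := by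
    intro z hz
    induction z using Sym2.ind with
    | h a b => rw [sym2Equiv_mk, Sym2.mk_isDiag_iff]; exact congrArg σ (Sym2.mk_isDiag_iff.1 hz)
  have hde' : ¬ ((sym2Equiv σ).symm e).IsDiag := by
    intro hd
    apply he
    rw [← (sym2Equiv σ).apply_symm_apply e]
    exact hdiag _ hd
  exact nc_of_relabel σ w hq0 ((sym2Equiv σ).apply_symm_apply e) ((sym2Equiv σ).apply_symm_apply f)
    (edgeNegCorrOn_fin_of_le_five hV hq0 hq1 (w ∘ sym2Equiv σ) _ _ hde' hne')

/-- **Single-edge monotonicity of connection probabilities (EC⁺) on every weighted graph with five vertices, `0 < q < 1`.**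
[cite: Grimmett2006, Thm. (3.21) (p. 43); §3.9 (p. 63)] -/
theorem edgeConnMonoOn_fin_five {q : ℝ} (hq0 : 0 < q) (hq1 : q < 1) : EdgeConnMonoOn (Fin 5) q :=
  edgeConnMonoOn_of_edgeNegCorrOn hq0 hq1 (edgeNegCorrOn_fin_five hq0 hq1.le)

/-- **Pairwise positive correlation of connection events on every weighted graph with five vertices, `0 < q < 1`.**
[cite: Grimmett2006, Thm. (3.21) (p. 43); §3.9 (p. 63)] -/
theorem pairConnPosUnder_fin_five {q : ℝ} (hq0 : 0 < q) (hq1 : q < 1) (w : Sym2 (Fin 5) → unitInterval) (x y u v : Fin 5) :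
    PairConnPosUnder (rcMeasureW w q ∅) x y u v :=
  pairConnPosUnder_of_edgeNegCorrOn hq0 hq1 (edgeNegCorrOn_fin_five hq0 hq1.le) w x y u v

/-- **The hub inequality on every weighted graph with five vertices, `0 < q < 1`** (Ayyer–Linusson–Ravichandran's (13) at every hub).
[cite: Grimmett2006, §3.9 (p. 63)] -/
theorem hubUnder_fin_five {q : ℝ} (hq0 : 0 < q) (hq1 : q < 1) (w : Sym2 (Fin 5) → unitInterval) (o a b : Fin 5) :
    HubUnder (rcMeasureW w q ∅) o a b :=
  hubUnder_of_pairConnPosUnder _ o a b (pairConnPosUnder_fin_five hq0 hq1 w o a b a)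

/-- **Connection probabilities are non-decreasing in every edge parameter on five vertices, `0 < q < 1`** — Grimmett's comparison
inequality (3.21) below `q = 1` for all weighted graphs with five vertices. [cite: Grimmett2006, Thm. (3.21) (p. 43); §5.8] -/
theorem rcMeasureW_real_openConn_mono_fin_five {q : ℝ} (hq0 : 0 < q) (hq1 : q < 1) {w w' : Sym2 (Fin 5) → unitInterval}
    (hww : ∀ e, (w e : ℝ) ≤ w' e) (x y : Fin 5) :
    (rcMeasureW w q ∅).real (openConn x y) ≤ (rcMeasureW w' q ∅).real (openConn x y) :=
  rcMeasureW_real_openConn_mono_of_edgeConnMonoOn hq0 (edgeConnMonoOn_fin_five hq0 hq1) hww x y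

end FK

end Summit.CriticalPhenomena.PercolationContinuityZ3.Theorems

end
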